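import Summits.QuantumFields.YangMills.Theorems.BalabanUVNodesN16ScalarAverageChern
import Summits.QuantumFields.BalabanUV.T4Continuum.Support.MinimalActionCompact
import HarnessLib

/-!
# YM-DAG node N16 (NE3), the re-keyed N07 in-edge — FLUX TRANSPORT FOR SCALAR COMPETITORS: the `j`-fold average (43) preserves the total principal flux of a period
# square (leaf-05's regime), the total flux does not depend on the slice (Bianchi), and an ADMISSIBLE scalar competitor at a uniform-curvature datum `ω` has total
# `(e₀,e₁)`-flux `N²ω` on EVERY slice and `(N L^k)^d · N²ω` over its period box (file 5 of the g6 piece; input of the Jensen step, file 6)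

Cell `pub-ymgap`, width seat `pub-ymgap-dag-n16-w2` (director-ym №197 ∕ HUMAN RULING D-0149), generation 6.  `--kind proof --supports stmt-QuantumFields-27366 --as helper`
(K3⁸, KEY MAP v2).  `bears_on: R4∕N16`, edge N07 → N16.  COUNT-NEUTRAL.

HONEST FRAMING.  Kernel bookkeeping over file 4 (`…N16ScalarAverageChern.chern_step`), [Balaban1985Averaging] Prop. 2 at every level (leaf-05
`MinimalActionCompact.avgIter_unitary_smallField_two`), the shift-invariance of periodic sums (`T4AveragingDeficitWallBoundary.sum_periodBox_shift`) and the lattice Bianchi identity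
for real potentials.  Nothing of Bałaban is asserted or refuted; DischargeTest `stub_reg910Slot` NOT closed; no K3⁸ v6 stub named or closed; N16 ∕ N07 NOT discharged; counts UNMOVED
(typed 28∕28 · discharged 5∕27 · A 5∕28).  R4 closes the conditional finite-𝕋⁴ rung `BalabanLadder.UV` only; NOT ℝ⁴ ∕ OS ∕ mass gap; the YM mass gap (Clay) is NOT proved by any of this.

NOTATION (def-free).  `U_A = scalarCfg (iA)` for a REAL potential `A`; `θ_A(x) = toIocMod 2π (−π) (asum A x (plaqWord κ μ))` its principal `(e_κ,e_μ)`-angle; the period-square flux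
`S_A(t, M) = Σ_{i,j<M} θ_A(t + i e_κ + j e_μ)`.

WHAT IS PROVED ([folklore], 0 `sorry`, 0 `def`; matrix size `n : Type`).  §1 ★★ `chern_iter`: in leaf-05's regime (`16C₀ε ≤ 3`, `1024(d+1)(d+4)L²ε ≤ 1`, `L ≥ 2`), for `U_A`
`(N·L^k)`-periodic with `SmallField U_A (ε∕(L^k)²)` and every `j ≤ k`, some real potential `A_j` presents `avgIter L U_A j` and `S_{A_j}(0, N L^{k−j}) = S_A(0, N L^k)`.  §2 BIANCHI:
`curl_curl_real` (the real identity `∂_ν F_{κμ} = ∂_κ F_{νμ} − ∂_μ F_{νκ}` for `F = dA`), `toIocMod_periodic` (the principal angles of a periodic `U_A` are periodic), ★ `bianchi_toIocMod`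
(the same identity for the PRINCIPAL angles when all six are `< π∕3` — here `≤ 2a ≤ 1`), ★ `sliceFlux_add_e` ∕ `sliceFlux_const` (`S_A(t + e_ν, M) = S_A(t, M)` for every `ν`, hence
`S_A(t, M) = S_A(0, M)`: periodicity in the plane, Bianchi across it).  §3 ★★ `sum_periodBox_toIocMod_eq` (`Σ_{x ∈ [0,M)^d} θ_A(x) · M² = M^d · S_A(0, M)` — averaging the shift
invariance of periodic box sums; no coordinate splitting), ★★★ `sliceFlux_of_admissible` (two conjuncts): for an ADMISSIBLE scalar competitor `U_A ∈ sfClass (d+2) L N e k`,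
`avgIter L U_A k = V` at an `N`-periodic scalar datum `V` of uniform `(e₀,e₁)`-curvature `ω` (`|ω| ≤ 1∕2`), `S_A(t, N L^k) = N²ω` for EVERY `t`, and
`Σ_{x ∈ [0, NL^k)^{d+2}} θ_A(x) = (N L^k)^d · N² ω` — i.e. the MEAN principal `(e₀,e₁)`-angle of every admissible competitor is exactly `ω ∕ L^{2k}`.

DEPENDENCES (by name): file 4 (`chern_step`, `abs_toIocMod_le_two_mul`, `toIocMod_eq_of_cexp_smul_one_eq`, `val_hol_plaqWord_real`, `cexp_toIocMod_mul_I`); file 3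
(`const_of_forall_add_e`); `MinimalActionCompact.avgIter_unitary_smallField_two`; `MinimalActionLevels.isPeriodicCfg_rescale_bavg` (via file 3's `isPeriodicCfg_avgIter'`);
`T4AveragingDeficitWallBoundary` (`scalarCfg`, `IsPeriodicCfg`, `periodBox`, `sum_periodBox_shift`, `card_periodBox`); `T4AveragingDeficitNonAbelian.hol_add_period`;
`MinimalActionSandwich.admissible`; `MinimalActionRate.sfClass`; `B7Prop1Explicit` (`asum_plaqWord`, `e`); Mathlib (`toIocMod_mem_Ioc`, `toIocMod_add_toIocDiv_zsmul`,
`Finset.sum_range_sub`, `Finset.sum_range_succ_comm`, `Finset.sum_comm`).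
-/

open scoped BigOperators Matrix Matrix.Norms.L2Operator
open NormedSpace Finset

namespace Summit.QuantumFields.YangMills.BalabanUVNodes.N16ScalarFluxTransport

open Literature.MathematicalPhysics.QuantumFieldTheory.Balaban1983to89
open B7Prop1Explicit B7Prop2Explicit MatrixLog UnitaryModel
open T4AveragingDeficitWall hiding Site Plane Plaq Bond
open T4AveragingDeficitWallBoundary (scalarCfg hol_scalarCfg IsPeriodicCfg periodBox sum_periodBox_shift card_periodBox fin_zero_ne_one)
open FederbushMean (cexp_smul_one)
open T4AveragingDeficitNonAbelian (hol_add_period)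
open Summit.QuantumFields.BalabanUV.T4Continuum
open MinimalActionClassSixNeg (isUnitaryCfg_scalarCfg_imag)
open MinimalActionCompact (avgIter_unitary_smallField_two)
open MinimalActionSandwich (admissible)
open MinimalActionRate (sfClass)
open Summit.QuantumFields.YangMills.BalabanUVNodes.N16Exists8UniformScalar (const_of_forall_add_e isPeriodicCfg_avgIter')
open Summit.QuantumFields.YangMills.BalabanUVNodes.N16ScalarAverageChern (chern_step abs_toIocMod_le_two_mul toIocMod_eq_of_cexp_smul_one_eq val_hol_plaqWord_real
  cexp_toIocMod_mul_I)

noncomputable section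

variable {d : ℕ} {n : Type} [Fintype n] [DecidableEq n]

/-! ## §1 The `j`-fold average preserves the total principal flux of a period square (leaf-05's regime) -/

/-- **★★ THE `j`-FOLD AVERAGE PRESERVES THE TOTAL PRINCIPAL FLUX OF A PERIOD SQUARE** (leaf-05's regime `16C₀ε ≤ 3`, `1024(d+1)(d+4)L²ε ≤ 1`, `L ≥ 2`): if `U_A` is
`(N·L^k)`-periodic with `SmallField U_A (ε∕(L^k)²)`, then for every `j ≤ k` some real potential `A_j` presents `avgIter L U_A j`, and
`Σ_{[0, N·L^{k−j})²} θ_{A_j} = Σ_{[0, N·L^k)²} θ_A` (base point `0`, plane `(e_κ, e_μ)`) — file 4's `chern_step` iterated, [Balaban1985Averaging] Prop. 2 keeping every level `2ε`-small.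
[cite: Balaban1985Averaging, (43) p.24, Prop. 2 (54) p.26] -/
theorem chern_iter [Nonempty n] {L : ℕ} (hL : 2 ≤ L) {N : ℕ} {ε : ℝ} (hε0 : 0 ≤ ε) (hε1 : 16 * C0 d * ε ≤ 3)
    (hε2 : 1024 * (d + 1) * (d + 4) * (L : ℝ) ^ 2 * ε ≤ 1) {k : ℕ} {A : B7Prop1Explicit.Site d → Fin d → ℝ}
    (hper : IsPeriodicCfg (scalarCfg (n := n) (fun y ν => ((A y ν : ℝ) : ℂ) * Complex.I)) ((N * L ^ k : ℕ) : ℤ))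
    (hUε : SmallField (scalarCfg (n := n) (fun y ν => ((A y ν : ℝ) : ℂ) * Complex.I)) (ε / ((L : ℝ) ^ k) ^ 2)) {κ μ : Fin d} (hκμ : κ ≠ μ) :
    ∀ j : ℕ, j ≤ k → ∃ Aj : B7Prop1Explicit.Site d → Fin d → ℝ,
      avgIter L (scalarCfg (n := n) (fun y ν => ((A y ν : ℝ) : ℂ) * Complex.I)) j = scalarCfg (n := n) (fun y ν => ((Aj y ν : ℝ) : ℂ) * Complex.I) ∧
      ∑ i ∈ Finset.range (N * L ^ (k - j)), ∑ i' ∈ Finset.range (N * L ^ (k - j)),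
          toIocMod Real.two_pi_pos (-Real.pi) (asum Aj ((i : ℤ) • e κ + (i' : ℤ) • e μ) (plaqWord κ μ))
        = ∑ i ∈ Finset.range (N * L ^ k), ∑ i' ∈ Finset.range (N * L ^ k),
          toIocMod Real.two_pi_pos (-Real.pi) (asum A ((i : ℤ) • e κ + (i' : ℤ) • e μ) (plaqWord κ μ))
  | 0, _ => ⟨A, by simp, by simp⟩
  | j + 1, hj => by
    have hL1 : 1 ≤ L := by omega
    obtain ⟨Aj, hAj, hflux⟩ := chern_iter hL hε0 hε1 hε2 hper hUε hκμ j (by omega)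
    -- level `j` is `(N·L^{k−j})`-periodic and `2ε`-small (Prop. 2 at every level)
    have hsm := (avgIter_unitary_smallField_two hL (isUnitaryCfg_scalarCfg_imag A) hε0 hε1 hε2 hUε (j := j) (by omega)).2
    rw [hAj] at hsm
    have hperj : IsPeriodicCfg (scalarCfg (n := n) (fun y ν => ((Aj y ν : ℝ) : ℂ) * Complex.I)) ((L * (N * L ^ (k - (j + 1))) : ℕ) : ℤ) := by
      rw [← hAj]
      refine isPeriodicCfg_avgIter' L j ?_
      have e1 : (L : ℤ) ^ j * ((L * (N * L ^ (k - (j + 1))) : ℕ) : ℤ) = ((N * L ^ k : ℕ) : ℤ) := by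
        have hk : k = j + 1 + (k - (j + 1)) := by omega
        conv_rhs => rw [hk]
        push_cast; ring
      rw [e1]; exact hper
    have hsmall : 512 * (d + 1) * (d + 4) * (L : ℝ) ^ 2 * (2 * ε) ≤ 1 := by linarith
    obtain ⟨B, hB, hstep⟩ := chern_step (n := n) (P := N * L ^ (k - (j + 1))) hL1 (by linarith) hsmall hsm hperj hκμ
    refine ⟨B, ?_, ?_⟩
    · rw [avgIter_succ, hAj, hB]
    · have h0 := hstep 0
      simp only [smul_zero, zero_add] at h0
      have e2 : L * (N * L ^ (k - (j + 1))) = N * L ^ (k - j) := by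
        have hk : k - j = (k - (j + 1)) + 1 := by omega
        rw [hk, pow_succ]; ring
      rw [e2] at h0
      rw [h0, hflux]

/-! ## §2 Bianchi: the principal flux of a period square does not depend on the slice -/

/-- **The lattice Bianchi identity for a real potential**: `F_{κμ}(x + e_ν) − F_{κμ}(x) = (F_{νμ}(x + e_κ) − F_{νμ}(x)) − (F_{νκ}(x + e_μ) − F_{νκ}(x))`, `F = dA` (`d ∘ d = 0`).
[folklore] -/
theorem curl_curl_real (A : B7Prop1Explicit.Site d → Fin d → ℝ) (x : B7Prop1Explicit.Site d) (κ μ ν : Fin d) :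
    asum A (x + e ν) (plaqWord κ μ) - asum A x (plaqWord κ μ)
      = (asum A (x + e κ) (plaqWord ν μ) - asum A x (plaqWord ν μ)) - (asum A (x + e μ) (plaqWord ν κ) - asum A x (plaqWord ν κ)) := by
  simp only [asum_plaqWord]
  have h1 : x + e ν + e κ = x + e κ + e ν := by abel
  have h2 : x + e ν + e μ = x + e μ + e ν := by abel
  have h3 : x + e κ + e μ = x + e μ + e κ := by abel
  rw [h1, h2, h3]
  ring

/-- If `|t − s − (u − v)| < 2π`-type bookkeeping: an integer multiple of `2π` of absolute value `< 2π` vanishes. [folklore] -/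
theorem zsmul_two_pi_eq_zero_of_abs_lt {m : ℤ} (h : |(m : ℝ) * (2 * Real.pi)| < 2 * Real.pi) : m = 0 := by
  have hπ : 0 < 2 * Real.pi := by positivity
  rw [abs_mul, abs_of_pos hπ] at h
  have h1 : |(m : ℝ)| < 1 := by nlinarith [abs_nonneg (m : ℝ)]
  have h2 : |m| < 1 := by exact_mod_cast h1
  exact Int.abs_lt_one_iff.mp h2

/-- **★ BIANCHI FOR THE PRINCIPAL ANGLES**: if all six principal angles involved are `≤ 1` in absolute value (here: `SmallField U_A a`, `2a ≤ 1`), the Bianchi identity holds for them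
EXACTLY (it holds mod `2π` by `curl_curl_real`, and the defect is an integer multiple of `2π` of size `< 2π`). [folklore] -/
theorem bianchi_toIocMod [Nonempty n] {A : B7Prop1Explicit.Site d → Fin d → ℝ} {a : ℝ} (ha : 2 * a ≤ 1)
    (hUa : SmallField (scalarCfg (n := n) (fun y ν => ((A y ν : ℝ) : ℂ) * Complex.I)) a) (x : B7Prop1Explicit.Site d) {κ μ ν : Fin d}
    (hκμ : κ ≠ μ) (hνμ : ν ≠ μ) (hνκ : ν ≠ κ) :
    toIocMod Real.two_pi_pos (-Real.pi) (asum A (x + e ν) (plaqWord κ μ)) - toIocMod Real.two_pi_pos (-Real.pi) (asum A x (plaqWord κ μ))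
      = (toIocMod Real.two_pi_pos (-Real.pi) (asum A (x + e κ) (plaqWord ν μ)) - toIocMod Real.two_pi_pos (-Real.pi) (asum A x (plaqWord ν μ)))
        - (toIocMod Real.two_pi_pos (-Real.pi) (asum A (x + e μ) (plaqWord ν κ)) - toIocMod Real.two_pi_pos (-Real.pi) (asum A x (plaqWord ν κ))) := by
  -- write each principal angle as `F − m•2π`
  have hdec : ∀ t : ℝ, ∃ m : ℤ, toIocMod Real.two_pi_pos (-Real.pi) t = t - m * (2 * Real.pi) := fun t =>
    ⟨toIocDiv Real.two_pi_pos (-Real.pi) t, by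
      have := toIocMod_add_toIocDiv_zsmul Real.two_pi_pos (-Real.pi) t
      rw [zsmul_eq_mul] at this; linarith⟩
  obtain ⟨m1, h1⟩ := hdec (asum A (x + e ν) (plaqWord κ μ))
  obtain ⟨m2, h2⟩ := hdec (asum A x (plaqWord κ μ))
  obtain ⟨m3, h3⟩ := hdec (asum A (x + e κ) (plaqWord ν μ))
  obtain ⟨m4, h4⟩ := hdec (asum A x (plaqWord ν μ))
  obtain ⟨m5, h5⟩ := hdec (asum A (x + e μ) (plaqWord ν κ))
  obtain ⟨m6, h6⟩ := hdec (asum A x (plaqWord ν κ))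
  have b1 := abs_toIocMod_le_two_mul (n := n) hUa (x + e ν) hκμ
  have b2 := abs_toIocMod_le_two_mul (n := n) hUa x hκμ
  have b3 := abs_toIocMod_le_two_mul (n := n) hUa (x + e κ) hνμ
  have b4 := abs_toIocMod_le_two_mul (n := n) hUa x hνμ
  have b5 := abs_toIocMod_le_two_mul (n := n) hUa (x + e μ) hνκ
  have b6 := abs_toIocMod_le_two_mul (n := n) hUa x hνκ
  have hreal := curl_curl_real A x κ μ ν
  -- the integer defect
  have hm : ((m1 - m2 - (m3 - m4) + (m5 - m6) : ℤ) : ℝ) * (2 * Real.pi)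
      = -(toIocMod Real.two_pi_pos (-Real.pi) (asum A (x + e ν) (plaqWord κ μ)) - toIocMod Real.two_pi_pos (-Real.pi) (asum A x (plaqWord κ μ))
        - ((toIocMod Real.two_pi_pos (-Real.pi) (asum A (x + e κ) (plaqWord ν μ)) - toIocMod Real.two_pi_pos (-Real.pi) (asum A x (plaqWord ν μ)))
          - (toIocMod Real.two_pi_pos (-Real.pi) (asum A (x + e μ) (plaqWord ν κ)) - toIocMod Real.two_pi_pos (-Real.pi) (asum A x (plaqWord ν κ))))) := by
    push_cast
    rw [h1, h2, h3, h4, h5, h6]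
    linarith
  have hπ : (3 : ℝ) < Real.pi := Real.pi_gt_three
  have hsmall : |((m1 - m2 - (m3 - m4) + (m5 - m6) : ℤ) : ℝ) * (2 * Real.pi)| < 2 * Real.pi := by
    rw [hm, abs_neg]
    rw [abs_le] at b1 b2 b3 b4 b5 b6
    rw [abs_lt]
    constructor <;> linarith [b1.1, b1.2, b2.1, b2.2, b3.1, b3.2, b4.1, b4.2, b5.1, b5.2, b6.1, b6.2]
  have h0 := zsmul_two_pi_eq_zero_of_abs_lt hsmall
  rw [h0] at hm
  simp only [Int.cast_zero, zero_mul] at hm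
  linarith

/-- **The principal angles of a periodic `U_A` are periodic** (they are read off the plaquette variables). [folklore] -/
theorem toIocMod_periodic [Nonempty n] {A : B7Prop1Explicit.Site d → Fin d → ℝ} {P : ℤ}
    (hper : IsPeriodicCfg (scalarCfg (n := n) (fun y ν => ((A y ν : ℝ) : ℂ) * Complex.I)) P) (x : B7Prop1Explicit.Site d) (ι κ μ : Fin d) :
    toIocMod Real.two_pi_pos (-Real.pi) (asum A (x + P • e ι) (plaqWord κ μ)) = toIocMod Real.two_pi_pos (-Real.pi) (asum A x (plaqWord κ μ)) := by
  apply toIocMod_eq_of_cexp_smul_one_eq (n := n)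
  have h1 := val_hol_plaqWord_real (n := n) A (x + P • e ι) κ μ
  have h2 := val_hol_plaqWord_real (n := n) A x κ μ
  rw [cexp_toIocMod_mul_I] at h1 h2
  rw [← h1, ← h2, hol_add_period hper ι]

section Slice

variable [Nonempty n] {A : B7Prop1Explicit.Site d → Fin d → ℝ} {a : ℝ} {M : ℕ} {κ μ : Fin d}

/-- **★ THE SLICE FLUX IS SHIFT-INVARIANT**: for `U_A` `M`-periodic with `SmallField U_A a`, `2a ≤ 1`, `κ ≠ μ`, the period-square flux `S_A(t, M) = Σ_{i,j<M} θ_A(t + i e_κ + j e_μ)`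
satisfies `S_A(t + e_ν, M) = S_A(t, M)` for EVERY direction `ν` (in-plane: periodicity; transverse: Bianchi + periodicity of the two transverse curls). [folklore] -/
theorem sliceFlux_add_e (ha : 2 * a ≤ 1) (hUa : SmallField (scalarCfg (n := n) (fun y ν => ((A y ν : ℝ) : ℂ) * Complex.I)) a)
    (hper : IsPeriodicCfg (scalarCfg (n := n) (fun y ν => ((A y ν : ℝ) : ℂ) * Complex.I)) (M : ℤ)) (hκμ : κ ≠ μ) (t : B7Prop1Explicit.Site d) (ν : Fin d) :
    ∑ i ∈ Finset.range M, ∑ j ∈ Finset.range M, toIocMod Real.two_pi_pos (-Real.pi) (asum A (t + e ν + (i : ℤ) • e κ + (j : ℤ) • e μ) (plaqWord κ μ))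
      = ∑ i ∈ Finset.range M, ∑ j ∈ Finset.range M, toIocMod Real.two_pi_pos (-Real.pi) (asum A (t + (i : ℤ) • e κ + (j : ℤ) • e μ) (plaqWord κ μ)) := by
  -- abbreviations
  have hθper : ∀ (y : B7Prop1Explicit.Site d) (ι α β : Fin d),
      toIocMod Real.two_pi_pos (-Real.pi) (asum A (y + (M : ℤ) • e ι) (plaqWord α β)) = toIocMod Real.two_pi_pos (-Real.pi) (asum A y (plaqWord α β)) :=
    fun y ι α β => toIocMod_periodic (n := n) hper y ι α β
  by_cases hνκ : ν = κ
  · -- in-plane shift along `κ`: reindex `i ↦ i + 1` over a full period (for each fixed `j`)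
    subst hνκ
    rw [Finset.sum_comm]
    conv_rhs => rw [Finset.sum_comm]
    refine Finset.sum_congr rfl fun j _ => ?_
    have hg : toIocMod Real.two_pi_pos (-Real.pi) (asum A (t + ((M : ℕ) : ℤ) • e ν + (j : ℤ) • e μ) (plaqWord ν μ))
        = toIocMod Real.two_pi_pos (-Real.pi) (asum A (t + ((0 : ℕ) : ℤ) • e ν + (j : ℤ) • e μ) (plaqWord ν μ)) := by
      rw [Nat.cast_zero, zero_smul, add_zero, show t + ((M : ℕ) : ℤ) • e ν + (j : ℤ) • e μ = t + (j : ℤ) • e μ + (M : ℤ) • e ν by abel]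
      exact hθper _ ν ν μ
    have h1 := Finset.sum_range_succ' (fun i : ℕ => toIocMod Real.two_pi_pos (-Real.pi) (asum A (t + (i : ℤ) • e ν + (j : ℤ) • e μ) (plaqWord ν μ))) M
    have h2 := Finset.sum_range_succ (fun i : ℕ => toIocMod Real.two_pi_pos (-Real.pi) (asum A (t + (i : ℤ) • e ν + (j : ℤ) • e μ) (plaqWord ν μ))) M
    rw [h2, hg] at h1
    have key2 : ∑ i ∈ Finset.range M, toIocMod Real.two_pi_pos (-Real.pi) (asum A (t + ((i + 1 : ℕ) : ℤ) • e ν + (j : ℤ) • e μ) (plaqWord ν μ))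
        = ∑ i ∈ Finset.range M, toIocMod Real.two_pi_pos (-Real.pi) (asum A (t + (i : ℤ) • e ν + (j : ℤ) • e μ) (plaqWord ν μ)) := by linarith
    rw [← key2]
    refine Finset.sum_congr rfl fun i _ => ?_
    congr 2; push_cast; rw [add_smul, one_smul]; abel
  by_cases hνμ : ν = μ
  · subst hνμ
    refine Finset.sum_congr rfl fun i _ => ?_
    have hg : toIocMod Real.two_pi_pos (-Real.pi) (asum A (t + (i : ℤ) • e κ + ((M : ℕ) : ℤ) • e ν) (plaqWord κ ν))
        = toIocMod Real.two_pi_pos (-Real.pi) (asum A (t + (i : ℤ) • e κ + ((0 : ℕ) : ℤ) • e ν) (plaqWord κ ν)) := by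
      rw [Nat.cast_zero, zero_smul, add_zero]
      exact hθper _ ν κ ν
    have h1 := Finset.sum_range_succ' (fun j : ℕ => toIocMod Real.two_pi_pos (-Real.pi) (asum A (t + (i : ℤ) • e κ + (j : ℤ) • e ν) (plaqWord κ ν))) M
    have h2 := Finset.sum_range_succ (fun j : ℕ => toIocMod Real.two_pi_pos (-Real.pi) (asum A (t + (i : ℤ) • e κ + (j : ℤ) • e ν) (plaqWord κ ν))) M
    rw [h2, hg] at h1
    have key2 : ∑ j ∈ Finset.range M, toIocMod Real.two_pi_pos (-Real.pi) (asum A (t + (i : ℤ) • e κ + ((j + 1 : ℕ) : ℤ) • e ν) (plaqWord κ ν))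
        = ∑ j ∈ Finset.range M, toIocMod Real.two_pi_pos (-Real.pi) (asum A (t + (i : ℤ) • e κ + (j : ℤ) • e ν) (plaqWord κ ν)) := by linarith
    rw [← key2]
    refine Finset.sum_congr rfl fun j _ => ?_
    congr 2; push_cast; rw [add_smul, one_smul]; abel
  -- transverse shift: Bianchi, then two telescopes killed by periodicity
  have hb : ∀ i j : ℕ, toIocMod Real.two_pi_pos (-Real.pi) (asum A (t + e ν + (i : ℤ) • e κ + (j : ℤ) • e μ) (plaqWord κ μ))
      = toIocMod Real.two_pi_pos (-Real.pi) (asum A (t + (i : ℤ) • e κ + (j : ℤ) • e μ) (plaqWord κ μ))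
        + (toIocMod Real.two_pi_pos (-Real.pi) (asum A (t + ((i + 1 : ℕ) : ℤ) • e κ + (j : ℤ) • e μ) (plaqWord ν μ))
            - toIocMod Real.two_pi_pos (-Real.pi) (asum A (t + (i : ℤ) • e κ + (j : ℤ) • e μ) (plaqWord ν μ)))
        - (toIocMod Real.two_pi_pos (-Real.pi) (asum A (t + (i : ℤ) • e κ + ((j + 1 : ℕ) : ℤ) • e μ) (plaqWord ν κ))
            - toIocMod Real.two_pi_pos (-Real.pi) (asum A (t + (i : ℤ) • e κ + (j : ℤ) • e μ) (plaqWord ν κ))) := by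
    intro i j
    have h := bianchi_toIocMod (n := n) ha hUa (t + (i : ℤ) • e κ + (j : ℤ) • e μ) hκμ hνμ hνκ
    have e1 : t + e ν + (i : ℤ) • e κ + (j : ℤ) • e μ = t + (i : ℤ) • e κ + (j : ℤ) • e μ + e ν := by abel
    have e2 : t + ((i + 1 : ℕ) : ℤ) • e κ + (j : ℤ) • e μ = t + (i : ℤ) • e κ + (j : ℤ) • e μ + e κ := by push_cast; rw [add_smul, one_smul]; abel
    have e3 : t + (i : ℤ) • e κ + ((j + 1 : ℕ) : ℤ) • e μ = t + (i : ℤ) • e κ + (j : ℤ) • e μ + e μ := by push_cast; rw [add_smul, one_smul]; abel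
    rw [e1, e2, e3]
    linarith
  -- telescope in `i` (for fixed `j`) and in `j` (for fixed `i`)
  have hti : ∀ j : ℕ, ∑ i ∈ Finset.range M,
      (toIocMod Real.two_pi_pos (-Real.pi) (asum A (t + ((i + 1 : ℕ) : ℤ) • e κ + (j : ℤ) • e μ) (plaqWord ν μ))
        - toIocMod Real.two_pi_pos (-Real.pi) (asum A (t + (i : ℤ) • e κ + (j : ℤ) • e μ) (plaqWord ν μ))) = 0 := by
    intro j
    rw [Finset.sum_range_sub (fun i : ℕ => toIocMod Real.two_pi_pos (-Real.pi) (asum A (t + (i : ℤ) • e κ + (j : ℤ) • e μ) (plaqWord ν μ))) M]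
    have := hθper (t + (j : ℤ) • e μ) κ ν μ
    rw [show t + (j : ℤ) • e μ + (M : ℤ) • e κ = t + ((M : ℕ) : ℤ) • e κ + (j : ℤ) • e μ by abel] at this
    simp only [Nat.cast_zero, zero_smul, add_zero]
    rw [this, sub_self]
  have htj : ∀ i : ℕ, ∑ j ∈ Finset.range M,
      (toIocMod Real.two_pi_pos (-Real.pi) (asum A (t + (i : ℤ) • e κ + ((j + 1 : ℕ) : ℤ) • e μ) (plaqWord ν κ))
        - toIocMod Real.two_pi_pos (-Real.pi) (asum A (t + (i : ℤ) • e κ + (j : ℤ) • e μ) (plaqWord ν κ))) = 0 := by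
    intro i
    rw [Finset.sum_range_sub (fun j : ℕ => toIocMod Real.two_pi_pos (-Real.pi) (asum A (t + (i : ℤ) • e κ + (j : ℤ) • e μ) (plaqWord ν κ))) M]
    have := hθper (t + (i : ℤ) • e κ) μ ν κ
    simp only [Nat.cast_zero, zero_smul, add_zero]
    rw [this, sub_self]
  have hP : ∑ i ∈ Finset.range M, ∑ j ∈ Finset.range M,
      (toIocMod Real.two_pi_pos (-Real.pi) (asum A (t + ((i + 1 : ℕ) : ℤ) • e κ + (j : ℤ) • e μ) (plaqWord ν μ))
        - toIocMod Real.two_pi_pos (-Real.pi) (asum A (t + (i : ℤ) • e κ + (j : ℤ) • e μ) (plaqWord ν μ))) = 0 := by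
    rw [Finset.sum_comm]
    exact Finset.sum_eq_zero fun j _ => hti j
  have hQ : ∑ i ∈ Finset.range M, ∑ j ∈ Finset.range M,
      (toIocMod Real.two_pi_pos (-Real.pi) (asum A (t + (i : ℤ) • e κ + ((j + 1 : ℕ) : ℤ) • e μ) (plaqWord ν κ))
        - toIocMod Real.two_pi_pos (-Real.pi) (asum A (t + (i : ℤ) • e κ + (j : ℤ) • e μ) (plaqWord ν κ))) = 0 :=
    Finset.sum_eq_zero fun i _ => htj i
  simp_rw [hb]
  simp only [Finset.sum_add_distrib, Finset.sum_sub_distrib]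
  simp only [Finset.sum_sub_distrib] at hP hQ
  linarith

/-- **★ THE SLICE FLUX IS THE SAME ON EVERY SLICE**: `S_A(t, M) = S_A(0, M)` for every base point `t`. [folklore] -/
theorem sliceFlux_const (ha : 2 * a ≤ 1) (hUa : SmallField (scalarCfg (n := n) (fun y ν => ((A y ν : ℝ) : ℂ) * Complex.I)) a)
    (hper : IsPeriodicCfg (scalarCfg (n := n) (fun y ν => ((A y ν : ℝ) : ℂ) * Complex.I)) (M : ℤ)) (hκμ : κ ≠ μ) (t : B7Prop1Explicit.Site d) :
    ∑ i ∈ Finset.range M, ∑ j ∈ Finset.range M, toIocMod Real.two_pi_pos (-Real.pi) (asum A (t + (i : ℤ) • e κ + (j : ℤ) • e μ) (plaqWord κ μ))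
      = ∑ i ∈ Finset.range M, ∑ j ∈ Finset.range M, toIocMod Real.two_pi_pos (-Real.pi) (asum A ((i : ℤ) • e κ + (j : ℤ) • e μ) (plaqWord κ μ)) := by
  have h := const_of_forall_add_e
    (m := fun t : B7Prop1Explicit.Site d => ∑ i ∈ Finset.range M, ∑ j ∈ Finset.range M,
      toIocMod Real.two_pi_pos (-Real.pi) (asum A (t + (i : ℤ) • e κ + (j : ℤ) • e μ) (plaqWord κ μ)))
    (fun z ν => sliceFlux_add_e (n := n) ha hUa hper hκμ z ν) t
  simpa only [zero_add] using h

/-! ## §3 The total principal flux of the period box; admissible competitors at a uniform-curvature datum -/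

/-- **★★ THE BOX TOTAL IS `M^d∕M²` SLICES' WORTH**: for `U_A` `M`-periodic with `SmallField U_A a`, `2a ≤ 1`, `M ≥ 1`:
`M² · Σ_{x ∈ [0,M)^d} θ_A(x) = M^d · S_A(0, M)` — averaging the shift-invariance of periodic box sums over the `M²` in-plane shifts (no coordinate splitting). [folklore] -/
theorem sum_periodBox_toIocMod_eq (hM : 1 ≤ M) (ha : 2 * a ≤ 1) (hUa : SmallField (scalarCfg (n := n) (fun y ν => ((A y ν : ℝ) : ℂ) * Complex.I)) a)
    (hper : IsPeriodicCfg (scalarCfg (n := n) (fun y ν => ((A y ν : ℝ) : ℂ) * Complex.I)) (M : ℤ)) (hκμ : κ ≠ μ) :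
    ((M : ℝ) ^ 2) * ∑ x ∈ periodBox M, toIocMod Real.two_pi_pos (-Real.pi) (asum A x (plaqWord κ μ))
      = (M : ℝ) ^ d * ∑ i ∈ Finset.range M, ∑ j ∈ Finset.range M, toIocMod Real.two_pi_pos (-Real.pi) (asum A ((i : ℤ) • e κ + (j : ℤ) • e μ) (plaqWord κ μ)) := by
  have hθper : ∀ (y : B7Prop1Explicit.Site d) (ι : Fin d),
      toIocMod Real.two_pi_pos (-Real.pi) (asum A (y + (M : ℤ) • e ι) (plaqWord κ μ)) = toIocMod Real.two_pi_pos (-Real.pi) (asum A y (plaqWord κ μ)) :=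
    fun y ι => toIocMod_periodic (n := n) hper y ι κ μ
  -- each in-plane shift of the box sum is the box sum
  have hshift : ∀ i j : ℕ, ∑ x ∈ periodBox M, toIocMod Real.two_pi_pos (-Real.pi) (asum A (x + ((i : ℤ) • e κ + (j : ℤ) • e μ)) (plaqWord κ μ))
      = ∑ x ∈ periodBox M, toIocMod Real.two_pi_pos (-Real.pi) (asum A x (plaqWord κ μ)) :=
    fun i j => sum_periodBox_shift M hM (g := fun y => toIocMod Real.two_pi_pos (-Real.pi) (asum A y (plaqWord κ μ))) hθper _
  calc ((M : ℝ) ^ 2) * ∑ x ∈ periodBox M, toIocMod Real.two_pi_pos (-Real.pi) (asum A x (plaqWord κ μ))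
      = ∑ i ∈ Finset.range M, ∑ j ∈ Finset.range M, ∑ x ∈ periodBox M,
          toIocMod Real.two_pi_pos (-Real.pi) (asum A (x + ((i : ℤ) • e κ + (j : ℤ) • e μ)) (plaqWord κ μ)) := by
        simp_rw [hshift]
        rw [Finset.sum_const, Finset.sum_const, Finset.card_range, smul_smul, nsmul_eq_mul]
        push_cast; ring
    _ = ∑ x ∈ periodBox M, ∑ i ∈ Finset.range M, ∑ j ∈ Finset.range M,
          toIocMod Real.two_pi_pos (-Real.pi) (asum A (x + (i : ℤ) • e κ + (j : ℤ) • e μ) (plaqWord κ μ)) := by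
        refine (Finset.sum_congr rfl fun i _ => Finset.sum_comm).trans ?_
        rw [Finset.sum_comm]
        refine Finset.sum_congr rfl fun x _ => Finset.sum_congr rfl fun i _ => Finset.sum_congr rfl fun j _ => ?_
        rw [add_assoc]
    _ = ∑ _x ∈ periodBox M, ∑ i ∈ Finset.range M, ∑ j ∈ Finset.range M,
          toIocMod Real.two_pi_pos (-Real.pi) (asum A ((i : ℤ) • e κ + (j : ℤ) • e μ) (plaqWord κ μ)) :=
        Finset.sum_congr rfl fun x _ => sliceFlux_const (n := n) ha hUa hper hκμ x
    _ = (M : ℝ) ^ d * ∑ i ∈ Finset.range M, ∑ j ∈ Finset.range M,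
          toIocMod Real.two_pi_pos (-Real.pi) (asum A ((i : ℤ) • e κ + (j : ℤ) • e μ) (plaqWord κ μ)) := by
        rw [Finset.sum_const, card_periodBox, nsmul_eq_mul]; push_cast; ring

end Slice

/-- **★★★ AN ADMISSIBLE SCALAR COMPETITOR AT A UNIFORM-CURVATURE DATUM CARRIES THE DATUM's FLUX ON EVERY SLICE** (`d + 2` dimensions, plane `(e₀,e₁)`, leaf-05's regime, `L ≥ 2`,
`N ≥ 1`, `|ω| ≤ 1∕2`): if `U_A ∈ sfClass (d+2) L N e k` has `avgIter L U_A k = V` where the `N`-periodic scalar datum `V = e^{iG}·1` has all `(e₀,e₁)`-plaquette variables `e^{iω}·1`,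
then `S_A(t, N L^k) = N² ω` for EVERY base point `t`, and `Σ_{x ∈ [0,NL^k)^{d+2}} θ_A(x) · (NL^k)² = (N L^k)^{d+2} · N² ω`: the MEAN principal angle of the competitor is `ω ∕ L^{2k}`.
[cite: Balaban1985Variational, (8) p.279] -/
theorem sliceFlux_of_admissible [Nonempty n] {L : ℕ} (hL : 2 ≤ L) {N : ℕ} (hN : 1 ≤ N) {ec : ℝ} (he0 : 0 ≤ ec) (he1 : 16 * C0 (d + 2) * ec ≤ 3)
    (he2 : 1024 * ((d + 2 : ℕ) + 1 : ℝ) * ((d + 2 : ℕ) + 4) * (L : ℝ) ^ 2 * ec ≤ 1) {k : ℕ} {ω : ℝ} (hω : |ω| ≤ 1 / 2)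
    {G A : B7Prop1Explicit.Site (d + 2) → Fin (d + 2) → ℝ}
    (hV01 : ∀ x : B7Prop1Explicit.Site (d + 2), hol (scalarCfg (n := n) (fun y ν => ((G y ν : ℝ) : ℂ) * Complex.I)) x (plaqWord 0 1)
      = expUnit ((((ω : ℝ) : ℂ) * Complex.I) • (1 : Matrix n n ℂ)))
    (hadm : scalarCfg (n := n) (fun y ν => ((A y ν : ℝ) : ℂ) * Complex.I)
      ∈ admissible (sfClass (d + 2) L N ec) L k (scalarCfg (n := n) (fun y ν => ((G y ν : ℝ) : ℂ) * Complex.I))) :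
    (∀ t : B7Prop1Explicit.Site (d + 2),
      ∑ i ∈ Finset.range (N * L ^ k), ∑ j ∈ Finset.range (N * L ^ k),
        toIocMod Real.two_pi_pos (-Real.pi) (asum A (t + (i : ℤ) • e 0 + (j : ℤ) • e 1) (plaqWord 0 1)) = (N : ℝ) ^ 2 * ω) ∧
    ((N * L ^ k : ℕ) : ℝ) ^ 2 * ∑ x ∈ periodBox (N * L ^ k), toIocMod Real.two_pi_pos (-Real.pi) (asum A x (plaqWord 0 1))
      = ((N * L ^ k : ℕ) : ℝ) ^ (d + 2) * ((N : ℝ) ^ 2 * ω) := by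
  obtain ⟨⟨_, hPer, hSm⟩, havg⟩ := hadm
  set M : ℕ := N * L ^ k with hMdef
  have hM : 1 ≤ M := Nat.one_le_iff_ne_zero.mpr (Nat.mul_ne_zero (by omega) (pow_ne_zero _ (by omega)))
  -- the competitor's radius `e/(L^k)² ≤ e ≤ 1/2048`, so `2a ≤ 1`
  have hL1r : (1 : ℝ) ≤ (L : ℝ) ^ k := one_le_pow₀ (by exact_mod_cast (show 1 ≤ L by omega))
  have hak : ec / ((L : ℝ) ^ k) ^ 2 ≤ ec := div_le_self he0 (one_le_pow₀ hL1r)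
  have he_small : 2 * (ec / ((L : ℝ) ^ k) ^ 2) ≤ 1 := by
    have hd0 : (0 : ℝ) ≤ d := by positivity
    have h4 : (4 : ℝ) ≤ ((d + 2 : ℕ) + 1 : ℝ) * ((d + 2 : ℕ) + 4) := by push_cast; nlinarith
    have hL2r : (2 : ℝ) ≤ L := by exact_mod_cast hL
    have hL2 : (1 : ℝ) ≤ (L : ℝ) ^ 2 := by nlinarith
    have h44 : (4 : ℝ) ≤ ((d + 2 : ℕ) + 1 : ℝ) * ((d + 2 : ℕ) + 4) * (L : ℝ) ^ 2 := by nlinarith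
    have : ec ≤ 1 / 4096 := by nlinarith
    linarith
  -- (1) `chern_iter` at `j = k`: the datum's period-square flux equals the competitor's
  obtain ⟨Ak, hAk, hflux⟩ := chern_iter (n := n) (d := d + 2) hL (N := N) he0 he1 he2 hPer hSm fin_zero_ne_one k le_rfl
  rw [havg, Nat.sub_self, pow_zero, mul_one] at *
  -- (2) the datum's principal angles are all `ω`
  have hθV : ∀ x : B7Prop1Explicit.Site (d + 2), toIocMod Real.two_pi_pos (-Real.pi) (asum Ak x (plaqWord 0 1)) = ω := by
    intro x
    have h1 := val_hol_plaqWord_real (n := n) Ak x 0 1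
    rw [cexp_toIocMod_mul_I, ← hAk, hV01 x, val_expUnit, ← cexp_smul_one] at h1
    have h2 := toIocMod_eq_of_cexp_smul_one_eq (n := n) h1
    rw [← h2, toIocMod_eq_self]
    have hπ : (3 : ℝ) < Real.pi := Real.pi_gt_three
    rw [abs_le] at hω
    constructor <;> linarith [hω.1, hω.2]
  simp_rw [hθV] at hflux
  rw [Finset.sum_const, Finset.sum_const, Finset.card_range, smul_smul, nsmul_eq_mul] at hflux
  have hS0 : ∑ i ∈ Finset.range M, ∑ j ∈ Finset.range M,
      toIocMod Real.two_pi_pos (-Real.pi) (asum A ((i : ℤ) • e 0 + (j : ℤ) • e 1) (plaqWord 0 1)) = (N : ℝ) ^ 2 * ω := by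
    rw [← hflux]; push_cast; ring
  have hslice := fun t => (sliceFlux_const (n := n) (κ := 0) (μ := 1) he_small hSm hPer fin_zero_ne_one t).trans hS0
  refine ⟨hslice, ?_⟩
  rw [sum_periodBox_toIocMod_eq (n := n) (κ := 0) (μ := 1) hM he_small hSm hPer fin_zero_ne_one, hS0]

end

end Summit.QuantumFields.YangMills.BalabanUVNodes.N16ScalarFluxTransport
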